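/-
Copyright (c) 2026. All rights reserved.
Released under Apache 2.0 license as described in the file LICENSE.
Authors: HodgeCM publication cell (pub-hodgecm), model-construction sub-cell, construction prover `mc-unitary-2` (gen 5).
-/
import Literature.NumberTheory.Weil1964.AdelicMetaplecticFinRep
import Literature.NumberTheory.Weil1964.AdelicMetaplecticThetaMajorants
import Literature.NumberTheory.Automorphic.UnitaryGroupLevelBasis
import HarnessLib

/-!
# Level fixing of the coset test vectors `𝟙_{x₀ + L}` by the finite Weil representation

Topic `NumberTheory/Weil1964`; namespace `Literature.NumberTheory.Weil1964`. REPRODUCTION (folklore level of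
[Weil1964, Chap. III n° 37–39] / [GelbartRogawski1991, §3.1]): kernel only, 0 records.

THE STATEMENT. Let `s : H → Mp_ψ(W_𝔸)ᶜᵒⁿᵗ` be continuous with `s 1 = 1`, `s(h) s(h⁻¹) = 1` (e.g. a continuous
homomorphism from a topological group), `T` invertible, `L ≤ (𝔸_F^∞)^ι` a compact open subgroup and `x₀ ∈ (𝔸_F^∞)^ι`.
Then for `h` NEAR `1` every finite implementer `M_f` of `π(s h)` (an endomorphism of `𝒮((𝔸_F^∞)^ι)` with
`(1 ⊗ M_f) ρ(η) = ρ(π(s h)·η) (1 ⊗ M_f)` on the finite Heisenberg elements) maps the COSET INDICATOR `𝟙_{x₀ + L}` to a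
multiple of itself (`eventually_implementer_finTranslateSB_indicatorSB_eq_smul`). For the finite factor
`ω_f(h) = finRepMp s h` of `ω(s h)` (`AdelicMetaplecticFinRep`) this reads
`ω_f(h) 𝟙_{x₀+𝔫𝒪̂^ι} = c_h 𝟙_{x₀+𝔫𝒪̂^ι}` near `1` (`eventually_finRepMp_cosetIndicatorSB_eq_smul`); the coefficient
`h ↦ (ω_f(h) f)(b)` is continuous (`continuous_finRepMp_apply_apply`); and when `H = U(J)(𝔸_{E,f})` is the
finite-adelic unitary group, the absence of small subgroups in `ℂˣ` (`UnitaryGroupLevelBasis`) upgrades "eigenvector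
near `1`" to "FIXED by a principal congruence level": there is `𝔪 ≠ 0` with
`ω_f(k) 𝟙_{x₀+𝔫𝒪̂^ι} = 𝟙_{x₀+𝔫𝒪̂^ι}` for all `k ∈ K_{U,f}(𝔪)`
(`exists_finCongruenceLevel_forall_finRepMp_cosetIndicatorSB_eq_self`; one level for finitely many coset test
vectors, `…_forall_forall_…`; a level `n𝓞_E`, `…_span_…`) — the hypothesis `hfix` of
`AdelicMetaplecticFinRep.omega_thinCosetTestFunₗ_eq_self`, whence `ω(s k)(Φ_∞ ⊗ 𝟙_{x₀+𝔫𝒪̂^ι}) = Φ_∞ ⊗ 𝟙_{x₀+𝔫𝒪̂^ι}`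
for all `Φ_∞` and all `k ∈ K_{U,f}(𝔪)` (`exists_finCongruenceLevel_forall_omega_thinCosetTestFunₗ_eq_self`).

THE PROOF is a shift of the case `x₀ = 0`, which is `AdelicMetaplecticThetaMajorants` §5
(`eventually_implementer_indicatorSB_eq_smul`: near `1`, `M_f 𝟙_L = μ_h 𝟙_L`, by the lattice rigidity of the
translations by `L` and the modulations by `L^♮`). Namely `𝟙_{x₀+L} = ρ_f(ŵ₀) 𝟙_L` for the finite translation element
`ŵ₀ = ((0, -x₀), 0)` (`finSchrodinger_ofVec_inl`), so `M_f 𝟙_{x₀+L} = ρ_f(g·ŵ₀)(M_f 𝟙_L) = μ_h ρ_f(g·ŵ₀) 𝟙_L`,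
`g = π(s h)`; and `ρ_f(g·ŵ₀) 𝟙_L = 𝟙_{x₀+L}` as soon as FOUR OPEN CONDITIONS hold at the single vector
`w₀ = ((0,-x₀), 0) ∈ W_𝔸` (`finSchrodinger_act_ofVec_indicatorSB_eq_finTranslateSB`): `((g w₀)₁)_f + x₀ ∈ L`,
`(T (g w₀)₂)_f ∈ L^♮` (open, `isOpen_dualBox`), `½ B(g w₀, g w₀)` finite-integral (its archimedean part vanishes since
`g w₀` is a finite vector), and `Σ_i (T (g w₀)₂)_{f,i} x₀_i ∈ 𝒪̂` — all four hold at `g = 1` and depend continuously on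
`g` through the orbit map `g ↦ g w₀` alone (`eventually_finSchrodinger_act_ofVec_indicatorSB_eq_finTranslateSB`).
The passage from "eigenvector on a neighbourhood of `1`" to "fixed vector of a congruence level" is
`UnitaryGroup.exists_finCongruenceLevel_forall_apply_eq_self` applied to the evaluation functional at `x₀`.

## References

* [Weil1964] A. Weil, *Sur certains groupes d'opérateurs unitaires*, Acta Math. 111 (1964), Chap. I n° 4 p. 149
  (the operators `U(w)`), n° 11 p. 158 (standard functions and their stabilisers), Chap. III n° 37–39 pp. 188–190
  (adelic metaplectic group; `Mp(X)_A` acts continuously on `𝒮(X_A)`).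
* [GelbartRogawski1991] S. Gelbart, J. Rogawski, *L-functions and Fourier–Jacobi coefficients for the unitary group
  U(3)*, Invent. Math. 105 (1991), §3.1 p. 454 (the Weil representation of the adelic metaplectic group restricted to
  unitary groups; smooth vectors are fixed by compact open subgroups).
* [MoeglinVignerasWaldspurger1987] C. Mœglin, M.-F. Vignéras, J.-L. Waldspurger, *Correspondances de Howe sur un corps
  p-adique*, LNM 1291 (1987), Chap. 2 I.3 (fixed vectors of lattices in the Schrödinger model), II.1 (A)–(B).
-/

noncomputable section

open scoped Matrix TensorProduct Topology SchwartzMap Classical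

open NumberField NumberField.mixedEmbedding IsDedekindDomain Filter

namespace Literature.NumberTheory.Weil1964

open Literature.NumberTheory.Automorphic Literature.RepresentationTheory.HeisenbergGroup

variable {F : Type} [Field F] [NumberField F] {ι : Type} [Fintype ι] [DecidableEq ι]
  {T : Matrix ι ι (AdeleRing (𝓞 F) F)}

/-! ## §1. The moved translation `g·ŵ₀` still produces `𝟙_{x₀+L}` from `𝟙_L` -/

section Shift

/-- **Four SUFFICIENT conditions under which `ρ_f(g·ŵ₀) 𝟙_L = 𝟙_{x₀+L}`**, `ŵ₀ = ((0,-x₀), 0)`: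
`((g w₀)₁)_f + x₀ ∈ L`, `(T (g w₀)₂)_f ∈ L^♮` (the `ψ_f`-dual box, `dualBox`), `½ B(g w₀, g w₀)` finite-integral,
`Σ_i (T (g w₀)₂)_{f,i} x₀_i ∈ 𝒪̂` (pointwise formula `coe_finSchrodinger_apply`; the archimedean part of
`B(g w₀, g w₀)` vanishes because `g w₀` is a finite vector; the last two conditions are `𝒪̂`-integrality, which
implies `ψ_f = 1` (`finiteAdeleAddChar_eq_one_of_forall_mem`) — sufficient, not the exact `ψ_f`-kernel condition,
and all that the openness argument below needs). [cite: Weil1964, Chap. I n° 11 p. 158] -/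
theorem finSchrodinger_act_ofVec_indicatorSB_eq_finTranslateSB (L : AddSubgroup (ι → FiniteAdeleRing (𝓞 F) F))
    (hLo : IsOpen (L : Set (ι → FiniteAdeleRing (𝓞 F) F)))
    (hLc : IsCompact (L : Set (ι → FiniteAdeleRing (𝓞 F) F))) (x₀ : ι → FiniteAdeleRing (𝓞 F) F)
    (g : symplecticGroup (polar (adelicForm F ι T)))
    (h1 : piFinite F ι ((g : ((ι → AdeleRing (𝓞 F) F) × (ι → AdeleRing (𝓞 F) F)) ≃ₗ[AdeleRing (𝓞 F) F]
        ((ι → AdeleRing (𝓞 F) F) × (ι → AdeleRing (𝓞 F) F))) (piAdeleSplit F ι (0, -x₀), 0)).1 + x₀ ∈ L)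
    (h2 : piFinite F ι (T *ᵥ ((g : ((ι → AdeleRing (𝓞 F) F) × (ι → AdeleRing (𝓞 F) F)) ≃ₗ[AdeleRing (𝓞 F) F]
        ((ι → AdeleRing (𝓞 F) F) × (ι → AdeleRing (𝓞 F) F))) (piAdeleSplit F ι (0, -x₀), 0)).2) ∈ dualBox F ι L)
    (h3 : (⅟(2 : AdeleRing (𝓞 F) F) *
        polar (adelicForm F ι T)
          ((g : ((ι → AdeleRing (𝓞 F) F) × (ι → AdeleRing (𝓞 F) F)) ≃ₗ[AdeleRing (𝓞 F) F]
            ((ι → AdeleRing (𝓞 F) F) × (ι → AdeleRing (𝓞 F) F))) (piAdeleSplit F ι (0, -x₀), 0))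
          ((g : ((ι → AdeleRing (𝓞 F) F) × (ι → AdeleRing (𝓞 F) F)) ≃ₗ[AdeleRing (𝓞 F) F]
            ((ι → AdeleRing (𝓞 F) F) × (ι → AdeleRing (𝓞 F) F))) (piAdeleSplit F ι (0, -x₀), 0))).2 ∈
        integralFiniteAdeles F)
    (h4 : ∑ i, piFinite F ι (T *ᵥ ((g : ((ι → AdeleRing (𝓞 F) F) × (ι → AdeleRing (𝓞 F) F)) ≃ₗ[AdeleRing (𝓞 F) F]
        ((ι → AdeleRing (𝓞 F) F) × (ι → AdeleRing (𝓞 F) F))) (piAdeleSplit F ι (0, -x₀), 0)).2) i * x₀ i ∈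
        integralFiniteAdeles F) :
    finSchrodinger T ((ofSymplectic (polar (adelicForm F ι T)) g).act
        (Heisenberg.ofVec (polar (adelicForm F ι T)) (piAdeleSplit F ι (0, -x₀), 0))) (indicatorSB F ι L hLo hLc) =
      finTranslateSB F ι (-x₀) (indicatorSB F ι L hLo hLc) := by
  set V : (ι → AdeleRing (𝓞 F) F) × (ι → AdeleRing (𝓞 F) F) :=
    (g : ((ι → AdeleRing (𝓞 F) F) × (ι → AdeleRing (𝓞 F) F)) ≃ₗ[AdeleRing (𝓞 F) F]
      ((ι → AdeleRing (𝓞 F) F) × (ι → AdeleRing (𝓞 F) F))) (piAdeleSplit F ι (0, -x₀), 0) with hVdef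
  -- `w₀` and `g w₀` are finite vectors; `B(w₀, w₀) = 0`
  have hw₀f : finIdem F • ((piAdeleSplit F ι (0, -x₀), (0 : ι → AdeleRing (𝓞 F) F)) :
      (ι → AdeleRing (𝓞 F) F) × (ι → AdeleRing (𝓞 F) F)) = (piAdeleSplit F ι (0, -x₀), 0) := by
    rw [Prod.smul_mk, finIdem_smul_piAdeleSplit_zero, smul_zero]
  have hVf : finIdem F • V = V := by
    rw [hVdef, ← map_smul, hw₀f]
  have hw₀ : polar (adelicForm F ι T) ((piAdeleSplit F ι (0, -x₀), (0 : ι → AdeleRing (𝓞 F) F)) :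
      (ι → AdeleRing (𝓞 F) F) × (ι → AdeleRing (𝓞 F) F)) (piAdeleSplit F ι (0, -x₀), 0) = 0 := by
    rw [polar_apply, map_zero]
  -- the central character is trivial on the moved element
  have hψt : adeleAddChar F (⅟(2 : AdeleRing (𝓞 F) F) * (polar (adelicForm F ι T) V V -
      polar (adelicForm F ι T) ((piAdeleSplit F ι (0, -x₀), (0 : ι → AdeleRing (𝓞 F) F)) :
        (ι → AdeleRing (𝓞 F) F) × (ι → AdeleRing (𝓞 F) F)) (piAdeleSplit F ι (0, -x₀), 0))) = 1 := by
    rw [hw₀, sub_zero]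
    refine adeleAddChar_eq_one_of_fst_eq_zero ?_ h3
    have h := fst_polar_adelicForm_finIdem_smul (T := T) V V
    rw [hVf] at h
    rw [show (⅟(2 : AdeleRing (𝓞 F) F) * polar (adelicForm F ι T) V V).1 =
      (⅟(2 : AdeleRing (𝓞 F) F)).1 * (polar (adelicForm F ι T) V V).1 from rfl, h, mul_zero]
  -- the modulation character is trivial at `x₀`
  have hψx : finiteAdeleAddChar F (∑ i, piFinite F ι (T *ᵥ V.2) i * x₀ i) = 1 :=
    finiteAdeleAddChar_eq_one_of_forall_mem F ((mem_integralFiniteAdeles_iff).1 h4)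
  apply Subtype.ext
  funext b
  rw [coe_finSchrodinger_apply, act_ofVec_t, act_ofVec_v, ← hVdef, hψt, Circle.coe_one, one_mul]
  simp only [coe_finTranslateSB_apply, coe_indicatorSB]
  by_cases hb : -x₀ + b ∈ L
  · -- on the coset `x₀ + L` both sides are `1`
    have hb' : piFinite F ι V.1 + b ∈ (L : Set (ι → FiniteAdeleRing (𝓞 F) F)) := by
      have h := L.add_mem h1 hb
      rwa [add_assoc, ← add_assoc x₀, add_neg_cancel, zero_add] at h
    have hsum : ∑ i, piFinite F ι (T *ᵥ V.2) i * b i =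
        ∑ i, piFinite F ι (T *ᵥ V.2) i * x₀ i + ∑ i, piFinite F ι (T *ᵥ V.2) i * (-x₀ + b) i := by
      rw [← Finset.sum_add_distrib]
      exact Finset.sum_congr rfl fun i _ => by rw [Pi.add_apply, Pi.neg_apply]; ring
    rw [Set.indicator_of_mem hb', Set.indicator_of_mem (show -x₀ + b ∈ (L : Set _) from hb), hsum,
      AddChar.map_add_eq_mul, hψx, one_mul, (mem_dualBox_iff (K := F)).1 h2 _ hb, Circle.coe_one, one_mul]
  · -- off the coset both sides vanish
    have hb' : piFinite F ι V.1 + b ∉ (L : Set (ι → FiniteAdeleRing (𝓞 F) F)) := fun hmem => hb (by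
      have h := L.sub_mem hmem h1
      rwa [show piFinite F ι V.1 + b - (piFinite F ι V.1 + x₀) = -x₀ + b from by abel] at h)
    rw [Set.indicator_of_notMem hb', Set.indicator_of_notMem (show -x₀ + b ∉ (L : Set _) from hb), mul_zero]

/-- **Eventual form.** Along an orbit-continuous family `z ↦ g(z) ∈ Sp(W_𝔸)` with `g(z₀) = 1`, for `z` near `z₀`:
`ρ_f(g(z)·ŵ₀) 𝟙_L = 𝟙_{x₀+L}` (the four conditions are open — `L`, `L^♮` (`isOpen_dualBox`) and `𝒪̂` are open — hold
at `g = 1`, and depend on `z` through the single orbit map `z ↦ g(z) w₀`). [cite: Weil1964, Chap. III n° 39 p. 189] -/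
theorem eventually_finSchrodinger_act_ofVec_indicatorSB_eq_finTranslateSB {Z : Type*} [TopologicalSpace Z]
    {z₀ : Z} {g : Z → symplecticGroup (polar (adelicForm F ι T))}
    (hg : ∀ w, Continuous fun z => ((g z : symplecticGroup (polar (adelicForm F ι T))) :
      ((ι → AdeleRing (𝓞 F) F) × (ι → AdeleRing (𝓞 F) F)) ≃ₗ[AdeleRing (𝓞 F) F]
        ((ι → AdeleRing (𝓞 F) F) × (ι → AdeleRing (𝓞 F) F))) w)
    (h0 : g z₀ = 1) (L : AddSubgroup (ι → FiniteAdeleRing (𝓞 F) F))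
    (hLo : IsOpen (L : Set (ι → FiniteAdeleRing (𝓞 F) F)))
    (hLc : IsCompact (L : Set (ι → FiniteAdeleRing (𝓞 F) F))) (x₀ : ι → FiniteAdeleRing (𝓞 F) F) :
    ∀ᶠ z in 𝓝 z₀,
      finSchrodinger T ((ofSymplectic (polar (adelicForm F ι T)) (g z)).act
          (Heisenberg.ofVec (polar (adelicForm F ι T)) (piAdeleSplit F ι (0, -x₀), 0))) (indicatorSB F ι L hLo hLc) =
        finTranslateSB F ι (-x₀) (indicatorSB F ι L hLo hLc) := by
  -- the moved vector `V z = g(z) w₀`, continuous in `z`, equal to `w₀` at `z₀`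
  set V : Z → (ι → AdeleRing (𝓞 F) F) × (ι → AdeleRing (𝓞 F) F) := fun z =>
    ((g z : symplecticGroup (polar (adelicForm F ι T))) :
      ((ι → AdeleRing (𝓞 F) F) × (ι → AdeleRing (𝓞 F) F)) ≃ₗ[AdeleRing (𝓞 F) F]
        ((ι → AdeleRing (𝓞 F) F) × (ι → AdeleRing (𝓞 F) F))) (piAdeleSplit F ι (0, -x₀), 0) with hVdef
  have hVc : Continuous V := hg _
  have hV0 : V z₀ = (piAdeleSplit F ι (0, -x₀), 0) := by
    simp only [hVdef, h0]
    rfl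
  have hB : Continuous fun w : (ι → AdeleRing (𝓞 F) F) × (ι → AdeleRing (𝓞 F) F) =>
      polar (adelicForm F ι T) w w := by
    have h : (fun w : (ι → AdeleRing (𝓞 F) F) × (ι → AdeleRing (𝓞 F) F) => polar (adelicForm F ι T) w w) =
        fun w => w.1 ⬝ᵥ (T *ᵥ w.2) := by
      funext w
      rw [polar_apply, adelicForm_apply]
    rw [h]
    exact continuous_fst.dotProduct (continuous_const.matrix_mulVec continuous_snd)
  -- the four condition maps are continuous
  have hc1 : Continuous fun z => piFinite F ι (V z).1 + x₀ :=
    (continuous_piFinite.comp (continuous_fst.comp hVc)).add continuous_const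
  have hc2 : Continuous fun z => piFinite F ι (T *ᵥ (V z).2) :=
    continuous_piFinite.comp (continuous_const.matrix_mulVec (continuous_snd.comp hVc))
  have hc3 : Continuous fun z => (⅟(2 : AdeleRing (𝓞 F) F) * polar (adelicForm F ι T) (V z) (V z)).2 :=
    continuous_snd.comp (continuous_const.mul (hB.comp hVc))
  have hc4 : Continuous fun z => ∑ i, piFinite F ι (T *ᵥ (V z).2) i * x₀ i :=
    continuous_finsetSum _ fun i _ => ((continuous_apply i).comp hc2).mul continuous_const
  -- and the four conditions hold at `z₀`
  have hw₀ : polar (adelicForm F ι T) ((piAdeleSplit F ι (0, -x₀), (0 : ι → AdeleRing (𝓞 F) F)) :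
      (ι → AdeleRing (𝓞 F) F) × (ι → AdeleRing (𝓞 F) F)) (piAdeleSplit F ι (0, -x₀), 0) = 0 := by
    rw [polar_apply, map_zero]
  have e1 : ∀ᶠ z in 𝓝 z₀, piFinite F ι (V z).1 + x₀ ∈ (L : Set (ι → FiniteAdeleRing (𝓞 F) F)) := by
    refine hc1.continuousAt.eventually_mem (hLo.mem_nhds ?_)
    show piFinite F ι (V z₀).1 + x₀ ∈ (L : Set (ι → FiniteAdeleRing (𝓞 F) F))
    rw [hV0, piFinite_piAdeleSplit, neg_add_cancel]
    exact L.zero_mem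
  have e2 : ∀ᶠ z in 𝓝 z₀, piFinite F ι (T *ᵥ (V z).2) ∈ (dualBox F ι L : Set (ι → FiniteAdeleRing (𝓞 F) F)) := by
    refine hc2.continuousAt.eventually_mem ((isOpen_dualBox L hLo hLc).mem_nhds ?_)
    show piFinite F ι (T *ᵥ (V z₀).2) ∈ (dualBox F ι L : Set (ι → FiniteAdeleRing (𝓞 F) F))
    rw [hV0, Matrix.mulVec_zero, piFinite_zero_vec]
    exact (dualBox F ι L).zero_mem
  have e3 : ∀ᶠ z in 𝓝 z₀, (⅟(2 : AdeleRing (𝓞 F) F) * polar (adelicForm F ι T) (V z) (V z)).2 ∈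
      (integralFiniteAdeles F : Set (FiniteAdeleRing (𝓞 F) F)) := by
    refine hc3.continuousAt.eventually_mem ((isOpen_integralFiniteAdeles F).mem_nhds ?_)
    show (⅟(2 : AdeleRing (𝓞 F) F) * polar (adelicForm F ι T) (V z₀) (V z₀)).2 ∈
      (integralFiniteAdeles F : Set (FiniteAdeleRing (𝓞 F) F))
    rw [hV0, hw₀, mul_zero]
    exact zero_mem _
  have e4 : ∀ᶠ z in 𝓝 z₀, ∑ i, piFinite F ι (T *ᵥ (V z).2) i * x₀ i ∈
      (integralFiniteAdeles F : Set (FiniteAdeleRing (𝓞 F) F)) := by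
    refine hc4.continuousAt.eventually_mem ((isOpen_integralFiniteAdeles F).mem_nhds ?_)
    show ∑ i, piFinite F ι (T *ᵥ (V z₀).2) i * x₀ i ∈ (integralFiniteAdeles F : Set (FiniteAdeleRing (𝓞 F) F))
    rw [hV0, Matrix.mulVec_zero, piFinite_zero_vec]
    simp only [Pi.zero_apply, zero_mul, Finset.sum_const_zero]
    exact zero_mem _
  filter_upwards [e1, e2, e3, e4] with z hz1 hz2 hz3 hz4
  have hw₀' : polar (adelicForm F ι T) (V z) (V z) = polar (adelicForm F ι T) (V z) (V z) -
      polar (adelicForm F ι T) ((piAdeleSplit F ι (0, -x₀), (0 : ι → AdeleRing (𝓞 F) F)) :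
        (ι → AdeleRing (𝓞 F) F) × (ι → AdeleRing (𝓞 F) F)) (piAdeleSplit F ι (0, -x₀), 0) := by
    rw [hw₀, sub_zero]
  exact finSchrodinger_act_ofVec_indicatorSB_eq_finTranslateSB L hLo hLc x₀ (g z) hz1 hz2 hz3 hz4

end Shift

/-! ## §2. Rigidity of the finite implementers on `𝟙_{x₀+L}` near `h = 1` -/

section Rigidity

/-- **Pointwise.** If `M_f` is a finite implementer of `g`, `M_f 𝟙_L = μ 𝟙_L`, and `ρ_f(g·ŵ₀) 𝟙_L = 𝟙_{x₀+L}`, then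
`M_f 𝟙_{x₀+L} = μ 𝟙_{x₀+L}` (`𝟙_{x₀+L} = ρ_f(ŵ₀) 𝟙_L`, `finSchrodinger_ofVec_inl`, and
`M_f ρ_f(ŵ₀) = ρ_f(g·ŵ₀) M_f`, `comp_finSchrodinger_of_finImplementer`). [cite: Weil1964, Chap. III n° 37 p. 188] -/
theorem implementer_finTranslateSB_indicatorSB_eq_smul (L : AddSubgroup (ι → FiniteAdeleRing (𝓞 F) F))
    (hLo : IsOpen (L : Set (ι → FiniteAdeleRing (𝓞 F) F)))
    (hLc : IsCompact (L : Set (ι → FiniteAdeleRing (𝓞 F) F))) (x₀ : ι → FiniteAdeleRing (𝓞 F) F)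
    {g : symplecticGroup (polar (adelicForm F ι T))} {Mf : FinSB F ι →ₗ[ℂ] FinSB F ι}
    (hMf : ∀ h ∈ finHeisenberg T, ∀ Φ : piSchwartzBruhat F ι,
      adelicTensorEnd LinearMap.id Mf (adelicSchrodinger F ι T h Φ) =
        adelicSchrodinger F ι T ((ofSymplectic (polar (adelicForm F ι T)) g).act h)
          (adelicTensorEnd LinearMap.id Mf Φ))
    {μ : ℂ} (hμ : Mf (indicatorSB F ι L hLo hLc) = μ • indicatorSB F ι L hLo hLc)
    (hfix : finSchrodinger T ((ofSymplectic (polar (adelicForm F ι T)) g).act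
        (Heisenberg.ofVec (polar (adelicForm F ι T)) (piAdeleSplit F ι (0, -x₀), 0))) (indicatorSB F ι L hLo hLc) =
      finTranslateSB F ι (-x₀) (indicatorSB F ι L hLo hLc)) :
    Mf (finTranslateSB F ι (-x₀) (indicatorSB F ι L hLo hLc)) =
      μ • finTranslateSB F ι (-x₀) (indicatorSB F ι L hLo hLc) := by
  have hη : Heisenberg.ofVec (polar (adelicForm F ι T)) (piAdeleSplit F ι (0, -x₀), 0) ∈ finHeisenberg T :=
    ofVec_mem_finHeisenberg (T := T) (finIdem_smul_piAdeleSplit_zero (-x₀)) (smul_zero _)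
  have h := LinearMap.congr_fun (comp_finSchrodinger_of_finImplementer hMf hη) (indicatorSB F ι L hLo hLc)
  rw [LinearMap.comp_apply, LinearMap.comp_apply, finSchrodinger_ofVec_inl, hμ, map_smul, hfix] at h
  exact h

variable {H : Type*} [Group H] [TopologicalSpace H] [IsTopologicalGroup H]

/-- **Lattice rigidity on the coset indicator near `1`.** For a continuous `s : H → Mp_ψ(W_𝔸)ᶜᵒⁿᵗ` with `s 1 = 1`,
`s(h) s(h⁻¹) = 1`, `T` invertible, `L` compact open and any `x₀`: for `h` near `1`, EVERY finite implementer `M_f`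
of `π(s h)` satisfies `M_f 𝟙_{x₀+L} = (M_f 𝟙_L)(0) 𝟙_{x₀+L}` (`eventually_implementer_indicatorSB_eq_smul` for
`x₀ = 0` and the shift §1). [cite: Weil1964, Chap. III n° 37–39 pp. 188–190] -/
theorem eventually_implementer_finTranslateSB_indicatorSB_eq_smul (hT : IsUnit T) (s : H → adelicMpCont F ι T)
    (hs : Continuous s) (hs1 : s 1 = 1) (hsinv : ∀ h : H, s h * s h⁻¹ = 1)
    (L : AddSubgroup (ι → FiniteAdeleRing (𝓞 F) F))
    (hLo : IsOpen (L : Set (ι → FiniteAdeleRing (𝓞 F) F)))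
    (hLc : IsCompact (L : Set (ι → FiniteAdeleRing (𝓞 F) F))) (x₀ : ι → FiniteAdeleRing (𝓞 F) F) :
    ∀ᶠ h in 𝓝 (1 : H), ∀ Mf : FinSB F ι →ₗ[ℂ] FinSB F ι,
      (∀ η ∈ finHeisenberg T, ∀ Φ : piSchwartzBruhat F ι,
        adelicTensorEnd LinearMap.id Mf (adelicSchrodinger F ι T η Φ) =
          adelicSchrodinger F ι T
            ((ofSymplectic (polar (adelicForm F ι T)) (adelicMpCont.proj F ι T (s h))).act η)
            (adelicTensorEnd LinearMap.id Mf Φ)) →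
      Mf (finTranslateSB F ι (-x₀) (indicatorSB F ι L hLo hLc)) =
        ((Mf (indicatorSB F ι L hLo hLc) : FinSB F ι) : (ι → FiniteAdeleRing (𝓞 F) F) → ℂ) 0 •
          finTranslateSB F ι (-x₀) (indicatorSB F ι L hLo hLc) := by
  have hg : ∀ w : (ι → AdeleRing (𝓞 F) F) × (ι → AdeleRing (𝓞 F) F), Continuous fun z : H =>
      ((adelicMpCont.proj F ι T (s z) : symplecticGroup (polar (adelicForm F ι T))) :
        ((ι → AdeleRing (𝓞 F) F) × (ι → AdeleRing (𝓞 F) F)) ≃ₗ[AdeleRing (𝓞 F) F]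
          ((ι → AdeleRing (𝓞 F) F) × (ι → AdeleRing (𝓞 F) F))) w :=
    fun w => (adelicMpCont.continuous_proj_apply w).comp hs
  have h0 : adelicMpCont.proj F ι T (s (1 : H)) = 1 := by rw [hs1, map_one]
  filter_upwards [eventually_implementer_indicatorSB_eq_smul hT s hs hs1 hsinv L hLo hLc,
    eventually_finSchrodinger_act_ofVec_indicatorSB_eq_finTranslateSB (T := T) hg h0 L hLo hLc x₀] with h hA hB Mf hMf
  exact implementer_finTranslateSB_indicatorSB_eq_smul L hLo hLc x₀ hMf (hA Mf hMf) hB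

end Rigidity

/-! ## §3. The finite factor `ω_f = finRepMp s` on the coset test vectors -/

section FinRep

omit [DecidableEq ι] in
/-- `𝟙_{x₀+𝔫𝒪̂^ι}(x₀) = 1`. [folklore] -/
theorem cosetIndicatorSB_apply_self (x₀ : ι → FiniteAdeleRing (𝓞 F) F) (𝔫 : Ideal (𝓞 F)) :
    ((cosetIndicatorSB F ι x₀ 𝔫 : FinSB F ι) : (ι → FiniteAdeleRing (𝓞 F) F) → ℂ) x₀ = 1 := by
  rw [cosetIndicatorSB]
  simp only [coe_finTranslateSB_apply, coe_indicatorSB, neg_add_cancel]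
  exact Set.indicator_of_mem (piLevelIdeal F ι 𝔫).zero_mem _

variable {H : Type*} [Group H] [TopologicalSpace H] [IsTopologicalGroup H]

omit [TopologicalSpace H] [IsTopologicalGroup H] in
/-- **`ω_f(h) = finRepMp s h` is a finite implementer of `π(s h)`** (`ω(s h) = 1 ⊗ ω_f(h)`,
`omega_eq_adelicTensorEnd_id_finRepMp`, and `ω(s h)` implements `π(s h)`, `mem_MpPsi`).
[cite: Weil1964, Chap. III n° 37–38 pp. 188–190] -/
theorem finRepMp_implements (hT : IsUnit T) (s : H →* adelicMpCont F ι T)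
    (harch : ∀ (h : H) (a w : ι → mixedSpace F),
      (adelicMpCont.proj F ι T (s h)).1 (archVec F ι a, archVec F ι w) = (archVec F ι a, archVec F ι w))
    (h : H) :
    ∀ η ∈ finHeisenberg T, ∀ Φ : piSchwartzBruhat F ι,
      adelicTensorEnd LinearMap.id (finRepMp hT s harch h) (adelicSchrodinger F ι T η Φ) =
        adelicSchrodinger F ι T
          ((ofSymplectic (polar (adelicForm F ι T)) (adelicMpCont.proj F ι T (s h))).act η)
          (adelicTensorEnd LinearMap.id (finRepMp hT s harch h) Φ) := by
  intro η _ Φ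
  -- `ω(s h)` implements `π(s h)` (membership in `Mp_ψ`); `ω(s h) Ψ = (s h).2 Ψ` is definitional.
  have hM : Implements (adelicSchrodinger F ι T)
      (ofSymplectic (polar (adelicForm F ι T)) (adelicMpCont.proj F ι T (s h))) ((s h : adelicMp F ι T) :
        symplecticGroup (polar (adelicForm F ι T)) × (piSchwartzBruhat F ι ≃ₗ[ℂ] piSchwartzBruhat F ι)).2 :=
    (mem_MpPsi _ _).1 (s h : adelicMp F ι T).2
  have hM' : ∀ Ψ : piSchwartzBruhat F ι, adelicMpCont.omega F ι T (s h) (adelicSchrodinger F ι T η Ψ) =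
      adelicSchrodinger F ι T ((ofSymplectic (polar (adelicForm F ι T)) (adelicMpCont.proj F ι T (s h))).act η)
        (adelicMpCont.omega F ι T (s h) Ψ) :=
    fun Ψ => hM η Ψ
  -- `ω(s h) = 1 ⊗ ω_f(h)` (term-mode: `rw` is prohibitively slow on goals containing `s h`)
  have hω : adelicMpCont.omega F ι T (s h) = adelicTensorEnd LinearMap.id (finRepMp hT s harch h) :=
    omega_eq_adelicTensorEnd_id_finRepMp hT s harch h
  have h1 : adelicTensorEnd LinearMap.id (finRepMp hT s harch h) (adelicSchrodinger F ι T η Φ) =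
      adelicMpCont.omega F ι T (s h) (adelicSchrodinger F ι T η Φ) := (LinearMap.congr_fun hω _).symm
  have h2 : adelicMpCont.omega F ι T (s h) Φ = adelicTensorEnd LinearMap.id (finRepMp hT s harch h) Φ :=
    LinearMap.congr_fun hω Φ
  exact h1.trans ((hM' Φ).trans (congrArg _ h2))

/-- **Near `1`, `ω_f(h)` maps `𝟙_{x₀+𝔫𝒪̂^ι}` to a multiple of itself**: for a continuous homomorphism
`s : H →* Mp_ψ(W_𝔸)ᶜᵒⁿᵗ` (symplectic components fixing the archimedean vectors), `T` invertible:
`∀ᶠ h, ω_f(h) 𝟙_{x₀+𝔫𝒪̂^ι} = (ω_f(h) 𝟙_{𝔫𝒪̂^ι})(0) · 𝟙_{x₀+𝔫𝒪̂^ι}`. [cite: GelbartRogawski1991, §3.1 p. 454] -/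
theorem eventually_finRepMp_cosetIndicatorSB_eq_smul (hT : IsUnit T) (s : H →* adelicMpCont F ι T)
    (hs : Continuous s)
    (harch : ∀ (h : H) (a w : ι → mixedSpace F),
      (adelicMpCont.proj F ι T (s h)).1 (archVec F ι a, archVec F ι w) = (archVec F ι a, archVec F ι w))
    (x₀ : ι → FiniteAdeleRing (𝓞 F) F) (𝔫 : Ideal (𝓞 F)) :
    ∀ᶠ h in 𝓝 (1 : H), finRepMp hT s harch h (cosetIndicatorSB F ι x₀ 𝔫) =
      ((finRepMp hT s harch h (indicatorSB F ι (piLevelIdeal F ι 𝔫) (isOpen_piLevelIdeal F 𝔫)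
          (isCompact_piLevelIdeal F ι 𝔫)) : FinSB F ι) : (ι → FiniteAdeleRing (𝓞 F) F) → ℂ) 0 •
        cosetIndicatorSB F ι x₀ 𝔫 := by
  have hsinv : ∀ h : H, s h * s h⁻¹ = 1 := fun h =>
    (map_mul s h h⁻¹).symm.trans ((congrArg s (mul_inv_cancel h)).trans (map_one s))
  filter_upwards [eventually_implementer_finTranslateSB_indicatorSB_eq_smul hT s hs (map_one s) hsinv
    (piLevelIdeal F ι 𝔫) (isOpen_piLevelIdeal F 𝔫) (isCompact_piLevelIdeal F ι 𝔫) x₀] with h hh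
  exact hh _ (finRepMp_implements hT s harch h)

omit [IsTopologicalGroup H] in
/-- **The coefficients `h ↦ (ω_f(h) f)(b)` are continuous** (they are matrix coefficients of `ω` along `s`,
`finSliceLM_apply_apply`, `adelicMpCont.continuous_omega_apply`). [cite: Weil1964, Chap. III n° 39 p. 189] -/
theorem continuous_finRepMp_apply_apply (hT : IsUnit T) (s : H →* adelicMpCont F ι T) (hs : Continuous s)
    (harch : ∀ (h : H) (a w : ι → mixedSpace F),
      (adelicMpCont.proj F ι T (s h)).1 (archVec F ι a, archVec F ι w) = (archVec F ι a, archVec F ι w))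
    (f : FinSB F ι) (b : ι → FiniteAdeleRing (𝓞 F) F) :
    Continuous fun h : H => ((finRepMp hT s harch h f : FinSB F ι) : (ι → FiniteAdeleRing (𝓞 F) F) → ℂ) b := by
  -- `(ω_f(h) f)(b) = (ω(s h) (𝟙_unit ⊗ f))(0, b)` (`finRepMp_apply`, `finPart_apply` are `rfl`;
  -- `finSliceLM_apply_apply`), a matrix coefficient of `ω` (`adelicMpCont.continuous_omega_apply`).
  have heq : (fun h : H => ((finRepMp hT s harch h f : FinSB F ι) : (ι → FiniteAdeleRing (𝓞 F) F) → ℂ) b) =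
      fun h : H => ((adelicMpCont.omega F ι T (s h)
        (piSchwartzBruhatEquiv F ι (unitSchwartz F ι ⊗ₜ f)) : piSchwartzBruhat F ι) :
          (ι → AdeleRing (𝓞 F) F) → ℂ) (piAdeleSplit F ι (0, b)) := by
    funext h
    show ((finSliceLM F ι 0 (adelicMpCont.omega F ι T (s h)
      (piSchwartzBruhatEquiv F ι (unitSchwartz F ι ⊗ₜ f))) : FinSB F ι) : (ι → FiniteAdeleRing (𝓞 F) F) → ℂ) b = _
    exact finSliceLM_apply_apply _ _ _
  rw [heq]
  exact (adelicMpCont.continuous_omega_apply _ _).comp hs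

end FinRep

/-! ## §4. The unitary case: a principal congruence level fixes `𝟙_{x₀+𝔫𝒪̂^ι}` -/

section Unitary

variable {F₁ E : Type} [Field F₁] [Field E] [NumberField E] [Algebra F₁ E] {c : E ≃ₐ[F₁] E} {N : ℕ}
  {J : Matrix (Fin N) (Fin N) E}

/-- **(W-Kf′) finite half — `hfix` on a principal congruence level.** Let `s : U(J)(𝔸_{E,f}) →* Mp_ψ(W_𝔸)ᶜᵒⁿᵗ` be a
continuous homomorphism whose symplectic components fix the archimedean vectors, `T` invertible. Then for every
`x₀` and `𝔫` there is an ideal `𝔪 ≠ 0` such that the finite Weil factor of every `k ∈ K_{U,f}(𝔪)` FIXES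
`𝟙_{x₀+𝔫𝒪̂^ι}`: `ω_f(k) 𝟙_{x₀+𝔫𝒪̂^ι} = 𝟙_{x₀+𝔫𝒪̂^ι}` (near `1` it is an eigenvector with continuous eigen-coefficient,
§3; an open subgroup of eigen-elements contains some `K_{U,f}(𝔫')`, `UnitaryGroup.exists_finCongruenceLevel_subset`;
no small subgroups in `ℂˣ`, `UnitaryGroup.exists_finCongruenceLevel_forall_apply_eq_self`). With
`AdelicMetaplecticFinRep.omega_thinCosetTestFunₗ_eq_self` this gives `ω(s k)(Φ_∞ ⊗ 𝟙_{x₀+𝔫𝒪̂^ι}) = Φ_∞ ⊗ 𝟙_{x₀+𝔫𝒪̂^ι}`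
for all `Φ_∞` and all `k ∈ K_{U,f}(𝔪)`. [cite: GelbartRogawski1991, §3.1 p. 454] -/
theorem exists_finCongruenceLevel_forall_finRepMp_cosetIndicatorSB_eq_self (hT : IsUnit T)
    (s : UnitaryGroup.finAdelic F₁ E c N J →* adelicMpCont F ι T) (hs : Continuous s)
    (harch : ∀ (k : UnitaryGroup.finAdelic F₁ E c N J) (a w : ι → mixedSpace F),
      (adelicMpCont.proj F ι T (s k)).1 (archVec F ι a, archVec F ι w) = (archVec F ι a, archVec F ι w))
    (x₀ : ι → FiniteAdeleRing (𝓞 F) F) (𝔫 : Ideal (𝓞 F)) :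
    ∃ 𝔪 : Ideal (𝓞 E), 𝔪 ≠ 0 ∧ ∀ k ∈ UnitaryGroup.finCongruenceLevel F₁ E c N J 𝔪,
      finRepMp hT s harch k (cosetIndicatorSB F ι x₀ 𝔫) = cosetIndicatorSB F ι x₀ 𝔫 := by
  -- an open subgroup of eigen-elements
  obtain ⟨𝔫', h𝔫'0, h𝔫'⟩ := UnitaryGroup.exists_finCongruenceLevel_subset
    (eventually_finRepMp_cosetIndicatorSB_eq_smul hT s hs harch x₀ 𝔫)
  -- the evaluation functional at `x₀`
  let ℓ : FinSB F ι →ₗ[ℂ] ℂ :=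
    { toFun := fun f => (f : (ι → FiniteAdeleRing (𝓞 F) F) → ℂ) x₀
      map_add' := fun _ _ => rfl
      map_smul' := fun _ _ => rfl }
  have hℓ : ℓ (cosetIndicatorSB F ι x₀ 𝔫) = 1 := cosetIndicatorSB_apply_self x₀ 𝔫
  obtain ⟨𝔪, h𝔪, -, hfix⟩ := UnitaryGroup.exists_finCongruenceLevel_forall_apply_eq_self
    (finRepMp hT s harch) (cosetIndicatorSB F ι x₀ 𝔫) ℓ hℓ
    (UnitaryGroup.isOpen_finCongruenceLevel F₁ E c N J h𝔫'0) (fun k hk => ⟨_, h𝔫' hk⟩)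
    ((continuous_finRepMp_apply_apply hT s hs harch _ x₀).continuousAt)
  exact ⟨𝔪, h𝔪, hfix⟩

/-- **One level for finitely many coset test vectors.** For a finite family `(x₀(a), 𝔫(a))_a` there is ONE
ideal `𝔪 ≠ 0` with `ω_f(k) 𝟙_{x₀(a)+𝔫(a)𝒪̂^ι} = 𝟙_{x₀(a)+𝔫(a)𝒪̂^ι}` for all `a` and all `k ∈ K_{U,f}(𝔪)` (the finite
intersection of the levels `K_{U,f}(𝔪_a)` is a neighbourhood of `1`, hence contains a principal congruence level,
`UnitaryGroup.exists_finCongruenceLevel_subset`). [cite: GelbartRogawski1991, §3.1 p. 454] -/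
theorem exists_finCongruenceLevel_forall_forall_finRepMp_cosetIndicatorSB_eq_self {A : Type*} [Finite A]
    (hT : IsUnit T) (s : UnitaryGroup.finAdelic F₁ E c N J →* adelicMpCont F ι T) (hs : Continuous s)
    (harch : ∀ (k : UnitaryGroup.finAdelic F₁ E c N J) (a w : ι → mixedSpace F),
      (adelicMpCont.proj F ι T (s k)).1 (archVec F ι a, archVec F ι w) = (archVec F ι a, archVec F ι w))
    (x₀ : A → ι → FiniteAdeleRing (𝓞 F) F) (𝔫 : A → Ideal (𝓞 F)) :
    ∃ 𝔪 : Ideal (𝓞 E), 𝔪 ≠ 0 ∧ ∀ a, ∀ k ∈ UnitaryGroup.finCongruenceLevel F₁ E c N J 𝔪,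
      finRepMp hT s harch k (cosetIndicatorSB F ι (x₀ a) (𝔫 a)) = cosetIndicatorSB F ι (x₀ a) (𝔫 a) := by
  choose 𝔪 h𝔪 hfix using fun a =>
    exists_finCongruenceLevel_forall_finRepMp_cosetIndicatorSB_eq_self hT s hs harch (x₀ a) (𝔫 a)
  have hU : (⋂ a, (UnitaryGroup.finCongruenceLevel F₁ E c N J (𝔪 a) : Set (UnitaryGroup.finAdelic F₁ E c N J))) ∈
      𝓝 (1 : UnitaryGroup.finAdelic F₁ E c N J) :=
    (Filter.iInter_mem).2 fun a => UnitaryGroup.finCongruenceLevel_mem_nhds_one (h𝔪 a)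
  obtain ⟨𝔪₀, h𝔪₀, hsub⟩ := UnitaryGroup.exists_finCongruenceLevel_subset hU
  exact ⟨𝔪₀, h𝔪₀, fun a k hk => hfix a k (Set.mem_iInter.1 (hsub hk) a)⟩

/-- **Natural-number level.** The same with a level `K_{U,f}(n𝓞_E)`, `n ≥ 1` (`K_{U,f}((Nm 𝔪)) ≤ K_{U,f}(𝔪)`,
`UnitaryGroup.finCongruenceLevel_span_absNorm_le`). [cite: GelbartRogawski1991, §3.1 p. 454] -/
theorem exists_finCongruenceLevel_span_forall_finRepMp_cosetIndicatorSB_eq_self {A : Type*} [Finite A]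
    (hT : IsUnit T) (s : UnitaryGroup.finAdelic F₁ E c N J →* adelicMpCont F ι T) (hs : Continuous s)
    (harch : ∀ (k : UnitaryGroup.finAdelic F₁ E c N J) (a w : ι → mixedSpace F),
      (adelicMpCont.proj F ι T (s k)).1 (archVec F ι a, archVec F ι w) = (archVec F ι a, archVec F ι w))
    (x₀ : A → ι → FiniteAdeleRing (𝓞 F) F) (𝔫 : A → Ideal (𝓞 F)) :
    ∃ n : ℕ, n ≠ 0 ∧ ∀ a, ∀ k ∈ UnitaryGroup.finCongruenceLevel F₁ E c N J (Ideal.span {(n : 𝓞 E)}),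
      finRepMp hT s harch k (cosetIndicatorSB F ι (x₀ a) (𝔫 a)) = cosetIndicatorSB F ι (x₀ a) (𝔫 a) := by
  obtain ⟨𝔪, h𝔪, hfix⟩ :=
    exists_finCongruenceLevel_forall_forall_finRepMp_cosetIndicatorSB_eq_self hT s hs harch x₀ 𝔫
  exact ⟨Ideal.absNorm 𝔪, Ideal.absNorm_eq_zero_iff.not.2 (by rwa [← Ideal.zero_eq_bot]),
    fun a k hk => hfix a k (UnitaryGroup.finCongruenceLevel_span_absNorm_le h𝔪 hk)⟩

/-- **The same, for all archimedean factors**: `ω(s k)(Φ_∞ ⊗ 𝟙_{x₀+𝔫𝒪̂^ι}) = Φ_∞ ⊗ 𝟙_{x₀+𝔫𝒪̂^ι}` for every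
`Φ_∞ ∈ 𝓢((F ⊗ ℝ)^ι)` and every `k` in the principal congruence level `K_{U,f}(𝔪)`.
[cite: GelbartRogawski1991, §3.1 p. 454] -/
theorem exists_finCongruenceLevel_forall_omega_thinCosetTestFunₗ_eq_self (hT : IsUnit T)
    (s : UnitaryGroup.finAdelic F₁ E c N J →* adelicMpCont F ι T) (hs : Continuous s)
    (harch : ∀ (k : UnitaryGroup.finAdelic F₁ E c N J) (a w : ι → mixedSpace F),
      (adelicMpCont.proj F ι T (s k)).1 (archVec F ι a, archVec F ι w) = (archVec F ι a, archVec F ι w))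
    (x₀ : ι → FiniteAdeleRing (𝓞 F) F) (𝔫 : Ideal (𝓞 F)) :
    ∃ 𝔪 : Ideal (𝓞 E), 𝔪 ≠ 0 ∧ ∀ k ∈ UnitaryGroup.finCongruenceLevel F₁ E c N J 𝔪,
      ∀ Φ : 𝓢((ι → mixedSpace F), ℂ),
        adelicMpCont.omega F ι T (s k) (thinCosetTestFunₗ (K := F) (ι := ι) x₀ 𝔫 Φ) =
          thinCosetTestFunₗ (K := F) (ι := ι) x₀ 𝔫 Φ := by
  -- (`have` + `Exists.imp`: `obtain … := <this application>` trips a slow `isDefEq` in `generalize`)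
  have hex := exists_finCongruenceLevel_forall_finRepMp_cosetIndicatorSB_eq_self hT s hs harch x₀ 𝔫
  exact hex.imp fun 𝔪 h => ⟨h.1, fun k hk Φ => omega_thinCosetTestFunₗ_eq_self hT s harch k x₀ 𝔫 (h.2 k hk) Φ⟩

end Unitary

end Literature.NumberTheory.Weil1964
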